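/-
Copyright: lit-balaban Phase-2 proof seat p30 (gen 26).  Statement-level skeleton of a published paper; no proof claims beyond what the
kernel checks below.
-/
import Literature.MathematicalPhysics.QuantumFieldTheory.BalabanImbrieJaffe1984to88.BIJ85Ineq722Torus

/-!
# [BalabanImbrieJaffe1985] §7.3 p. 326 — lattice plumbing for the interior estimates of the block propagator `G_k(u)` at small fields:
# **the product-tent cutoff `χ_{y₀,r}` on the torus `T^{(j)}`, sup-balls and slabs, radial profiles** (PUBLIC re-issue of the private
# plumbing of this seat's `BIJ85ScalarPropagatorSupDecayDeriv`, p345594, §§1–3/§5, plus the real-exponent radial sums of the Hölder member)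

T. Bałaban, J. Imbrie, A. Jaffe, *Renormalization of the Higgs model: minimizers, propagators and the stability of mean field theory*,
Commun. Math. Phys. **97** (1985) 299–329 [BalabanImbrieJaffe1985], §7.3 p. 326 [PDF 28] (*"by change of gauge u_k can be transformed in
a local region Λ into a configuration of the form exp[ie_kηA], where A is smooth and small"*); [7] there = T. Bałaban, *Regularity and decay
of lattice Green's functions*, Commun. Math. Phys. **89** (1983) 571–597 [Balaban1983RegularityDecay], (1.9)–(1.10) p. 573.

statement-level skeleton of published theorems with citation tags; proofs where landed; nothing here is a claim about the Yang–Mills mass gap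

CITATION HEADER (lean-in-tree rule).  Part of the lit-balaban TYPED SKELETON (HOME `run/shared/lean/pub/lit-balaban/`), PHASE-2 proof seat
p30 gen 26 (unit `lit-balaban-p30-g26`; TAKING line HOME/STATUS.md 2026-08-23T01:01:50Z; free-target protocol G.5-34(d) — the Hölder
residual of item 3 of `HOME/lit-balaban-r15/C1-CLOSURE.md` §5, owner r15).  WHAT THIS FILE IS: file 2 of the [7] (1.9) Hölder member for
row **C1.Eq7.3.1-7.3.2** of `HOME/lit-balaban-r15/ROWS-C1.md` (a located input of a located member; no head effect): the LATTICE PLUMBING of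
the "local region Λ" of p. 326 — the cutoff, the counting and the radial sums — which gen 25 kept `private` inside p345594 and which the Hölder
member (`BIJ85ScalarPropagatorSupDecayHolder`) needs again; re-issued here PUBLIC and unchanged (same statements and proofs, §§1–4), so
that p345594 is not touched, together with the NEW real-exponent radial sums of the Hölder member (§5).  Kind «definitions with bodies +
model-level lemmas» (`tentN`, `tentZ`, `tentC`, `chi`, `ball`, `slab` are concrete `def`s; no `Prop`-valued fact introduced).  Every
declaration is elementary lattice calculus ([folklore]); the citation tags record WHERE in the print the device is used.

THE OBJECTS.  On the torus `T^{(j)} = Site P j = Fin d → ZMod(sitesPerDir j)` with r15's sup distance `supDist` and circular coordinate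
distance `cdist` (`B3TorusRadialSums`): the tent `T_r(t) = 1 (t ≤ r), (2r−t)/r (r ≤ t ≤ 2r), 0 (t ≥ 2r)` read on `ℕ`, on `ℤ` and around the
circle `ZMod N` (`tentN`, `tentZ`, `tentC`); the product cutoff `χ_{y₀,r}(z) = Π_ν T_r(z_ν − y₀,ν)` (`chi`): `= 1` on the sup-ball of radius `r`,
`= 0` off the sup-ball of radius `2r − 1`, `1/r`-Lipschitz along bonds, second bond differences `≤ 2/r` and supported on the two kink slabs
`cdist(z_μ − y₀,μ) ∈ {r, 2r}` (all for `4r + 6 ≤ sitesPerDir j`: the support stays away from the antipode); the sup-ball `ball y₀ n` and the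
coordinate slab `slab y₀ n μ s` with the counts `(2n+1)^d`, `2(2n+1)^{d−1}`; the shell-by-shell bound `sum_le_radial` and the radial bounds for
the integer profiles `A/max(s,1)^{d−1}`, `A·s/max(s,1)^{d−1}` (§§3–4) and — NEW — for the real-exponent profiles of the Hölder envelopes of
`BIJ85FlatPropagatorKernelHolder`: `Σ_{s=1}^{n}s^{−β} ≤ n^{1−β}/(1−β)` (`0 ≤ β < 1`), `Σ_{s=1}^{n}s^{−1−β} ≤ 1 + 1/β` (`β > 0`) by Bernoulli's
inequality, and the resulting radial bounds (§5).

WHAT IS PROVED (0 `sorry`; standard axioms).  §1 tents (`tentN_*`, `tentZ_*`, `tentC_*`); §1b the cutoff (`chi_nonneg`, `chi_le_one`,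
`chi_eq_one_of_supDist_le`, `supDist_lt_of_chi_ne_zero`, `abs_chi_shift_sub_le`, `abs_chi_second_diff_le`,
`cdist_eq_of_chi_second_diff_ne_zero`, `supDist_le_of_chi_second_diff_ne_zero`, …); §2 `card_ball_le`, `card_slab_le`; §3 `sum_le_radial`,
`radial_sum_inv_pow_le`, `radial_sum_mul_inv_pow_le`; §4 `env_neighbour`, `env_far`, `radial_env_one`, `radial_env_T`; §5 `sum_rpow_neg_le`,
`sum_rpow_neg_succ_le`, `env_neighbour_rpow`, `env_far_rpow`, `radial_env_rpow`, `radial_env_rpow_T`, `radial_env_rpow_succ`.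

HONEST SCOPE.  Pure lattice calculus on the torus carrier; nothing here is an estimate of the paper; the cutoff is OUR device (the print's
"local region Λ" is not specified further).  Nothing here is summit progress.  Unit `lit-balaban-p30` (literature-prover-lit-balaban-p30-g26-0),
HOME `run/shared/lean/pub/lit-balaban/`, 2026-08-23.
-/

open scoped BigOperators
open Finset

namespace Literature.MathematicalPhysics.QuantumFieldTheory.BalabanImbrieJaffe1984to88.BIJ85TorusTentCutoff

open Literature.MathematicalPhysics.QuantumFieldTheory.Balaban1983to89
open LatticeFieldCalculus (supDist)
open B3TorusRadialSums (cdist cdist_le_supDist supDist_comm supDist_eq_sup_cdist supDist_eq_zero_iff shell card_shell_le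
  card_cdist_le_le card_cdist_eq_le cdist_neg cdist_le_val)
open BIJ85Ineq722Torus (supDist_triangle)

noncomputable section

/-! ## §1 The tent on `ℕ`, on `ℤ`, and around the circle `ZMod N` -/

section Tent

/-- The tent of flat radius `r` and support `2r` on the distance `t ∈ ℕ`: `1` for `t ≤ r`, `(2r − t)/r` for `r ≤ t ≤ 2r`, `0` beyond.
[folklore] -/
def tentN (r t : ℕ) : ℝ := if t ≤ r then 1 else if t ≤ 2 * r then ((2 * r - t : ℕ) : ℝ) / r else 0

variable {r : ℕ}

/-- kernel: `0 ≤ tent ≤ 1`. [cite: BalabanImbrieJaffe1985, p.326] -/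
theorem tentN_nonneg (r t : ℕ) : 0 ≤ tentN r t := by
  unfold tentN; split_ifs <;> positivity

/-- kernel: `tent ≤ 1`. [cite: BalabanImbrieJaffe1985, p.326] -/
theorem tentN_le_one (hr : 1 ≤ r) (t : ℕ) : tentN r t ≤ 1 := by
  unfold tentN
  split_ifs with h1 h2
  · exact le_rfl
  · rw [div_le_one (by exact_mod_cast hr)]
    have : 2 * r - t ≤ r := by omega
    exact_mod_cast this
  · exact zero_le_one

/-- kernel: the flat top. [cite: BalabanImbrieJaffe1985, p.326] -/
theorem tentN_of_le {t : ℕ} (ht : t ≤ r) : tentN r t = 1 := by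
  unfold tentN; rw [if_pos ht]

/-- kernel: outside the support. [cite: BalabanImbrieJaffe1985, p.326] -/
theorem tentN_of_ge (hr : 1 ≤ r) {t : ℕ} (ht : 2 * r ≤ t) : tentN r t = 0 := by
  unfold tentN
  split_ifs with h1 h2
  · omega
  · have : 2 * r - t = 0 := by omega
    rw [this]; simp
  · rfl

/-- kernel: the slope region formula, valid on the CLOSED interval `[r, 2r]`. [cite: BalabanImbrieJaffe1985, p.326] -/
theorem tentN_of_mem {t : ℕ} (hr : 1 ≤ r) (h1 : r ≤ t) (h2 : t ≤ 2 * r) : tentN r t = ((2 * r - t : ℕ) : ℝ) / r := by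
  unfold tentN
  split_ifs with h3
  · have : t = r := le_antisymm h3 h1
    subst this
    rw [show 2 * t - t = t by omega, div_self]
    exact_mod_cast (show (t : ℝ) ≠ 0 by exact_mod_cast (by omega : t ≠ 0))
  · rfl

/-- kernel: **the tent is `1/r`-Lipschitz** under unit steps of the distance. [cite: BalabanImbrieJaffe1985, p.326] -/
theorem abs_tentN_succ_sub_le (hr : 1 ≤ r) (t : ℕ) : |tentN r (t + 1) - tentN r t| ≤ 1 / r := by
  have hr0 : (0 : ℝ) < r := by exact_mod_cast hr
  have hr' : (0 : ℝ) ≤ 1 / r := by positivity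
  rcases lt_or_ge t r with h | h
  · -- both on the flat top
    rw [tentN_of_le h.le, tentN_of_le (by omega), sub_self, abs_zero]; exact hr'
  rcases lt_or_ge t (2 * r) with h' | h'
  · -- both in the closed slope region
    rw [tentN_of_mem hr h h'.le, tentN_of_mem hr (by omega) (by omega)]
    rw [← sub_div, abs_div, abs_of_pos hr0, div_le_div_iff_of_pos_right hr0]
    have : ((2 * r - (t + 1) : ℕ) : ℝ) - ((2 * r - t : ℕ) : ℝ) = -1 := by
      have e : 2 * r - t = (2 * r - (t + 1)) + 1 := by omega
      rw [e]; push_cast; ring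
    rw [this]; simp
  · rw [tentN_of_ge hr h', tentN_of_ge hr (by omega), sub_self, abs_zero]; exact hr'

/-- kernel: **the second difference of the tent vanishes off the two kinks** `t = r`, `t = 2r` (`t ≥ 1`). [cite: BalabanImbrieJaffe1985, p.326] -/
theorem tentN_second_diff_eq_zero (hr : 1 ≤ r) {t : ℕ} (ht : 1 ≤ t) (h1 : t ≠ r) (h2 : t ≠ 2 * r) :
    tentN r (t + 1) - 2 * tentN r t + tentN r (t - 1) = 0 := by
  rcases lt_or_gt_of_ne h1 with h | h
  · rw [tentN_of_le h.le, tentN_of_le (by omega), tentN_of_le (by omega)]; ring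
  rcases lt_or_gt_of_ne h2 with h' | h'
  · rw [tentN_of_mem hr h.le h'.le, tentN_of_mem hr (by omega) (by omega), tentN_of_mem hr (by omega) (by omega)]
    have hr0 : (r : ℝ) ≠ 0 := by exact_mod_cast (show r ≠ 0 by omega)
    field_simp
    have e1 : 2 * r - (t - 1) = (2 * r - (t + 1)) + 2 := by omega
    have e2 : 2 * r - t = (2 * r - (t + 1)) + 1 := by omega
    rw [e1, e2]; push_cast; ring
  · rw [tentN_of_ge hr h'.le, tentN_of_ge hr (by omega), tentN_of_ge hr (by omega)]; ring

/-- The tent read on a SIGNED integer offset `s` (through `|s|`). [folklore] -/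
def tentZ (r : ℕ) (s : ℤ) : ℝ := tentN r s.natAbs

/-- kernel: `|s + 1|` is `|s| + 1` or `|s| − 1`. [cite: BalabanImbrieJaffe1985, p.326] -/
theorem natAbs_add_one (s : ℤ) : (s + 1).natAbs = s.natAbs + 1 ∨ (s + 1).natAbs + 1 = s.natAbs := by omega

/-- kernel: the signed tent is `1/r`-Lipschitz under unit steps. [cite: BalabanImbrieJaffe1985, p.326] -/
theorem abs_tentZ_succ_sub_le (hr : 1 ≤ r) (s : ℤ) : |tentZ r (s + 1) - tentZ r s| ≤ 1 / r := by
  unfold tentZ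
  rcases natAbs_add_one s with h | h
  · rw [h]; exact abs_tentN_succ_sub_le hr _
  · rw [← h, abs_sub_comm]; exact abs_tentN_succ_sub_le hr _

/-- kernel: the signed second difference vanishes unless `|s| ∈ {r, 2r}`. [cite: BalabanImbrieJaffe1985, p.326] -/
theorem tentZ_second_diff_eq_zero (hr : 1 ≤ r) {s : ℤ} (h1 : s.natAbs ≠ r) (h2 : s.natAbs ≠ 2 * r) :
    tentZ r (s + 1) - 2 * tentZ r s + tentZ r (s - 1) = 0 := by
  unfold tentZ
  rcases lt_trichotomy s 0 with hs | hs | hs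
  · have e1 : (s + 1).natAbs = s.natAbs - 1 := by omega
    have e2 : (s - 1).natAbs = s.natAbs + 1 := by omega
    rw [e1, e2]
    have := tentN_second_diff_eq_zero hr (t := s.natAbs) (by omega) h1 h2
    linarith
  · subst hs
    simp only [zero_add, zero_sub, Int.natAbs_one, Int.natAbs_zero, Int.natAbs_neg]
    rw [tentN_of_le hr, tentN_of_le (Nat.zero_le _)]; ring
  · have e1 : (s + 1).natAbs = s.natAbs + 1 := by omega
    have e2 : (s - 1).natAbs = s.natAbs - 1 := by omega
    rw [e1, e2]
    exact tentN_second_diff_eq_zero hr (t := s.natAbs) (by omega) h1 h2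

variable {N : ℕ} [NeZero N]

/-- kernel: `|valMinAbs m| = cdist m`. [cite: BalabanImbrieJaffe1985, p.326] -/
theorem natAbs_valMinAbs_eq_cdist (m : ZMod N) : m.valMinAbs.natAbs = cdist m := by
  rw [ZMod.valMinAbs_natAbs_eq_min, cdist, ZMod.neg_val]
  split_ifs with h
  · subst h; simp
  · rfl

omit [NeZero N] in
/-- kernel: a unit step changes the least residue by at most `1` in absolute value: `|vm m| ≤ |vm(m + 1)| + 1`. [cite: BalabanImbrieJaffe1985, p.326] -/
theorem natAbs_valMinAbs_le_succ (hN : 3 ≤ N) (m : ZMod N) : m.valMinAbs.natAbs ≤ (m + 1).valMinAbs.natAbs + 1 := by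
  have h1 : ((-1 : ZMod N)).valMinAbs.natAbs ≤ 1 := by
    rw [ZMod.natAbs_valMinAbs_neg]
    have : ((1 : ℕ) : ZMod N).valMinAbs = (1 : ℕ) := ZMod.valMinAbs_natCast_of_le_half (by omega)
    rw [Nat.cast_one] at this
    rw [this]; simp
  have h := ZMod.natAbs_valMinAbs_add_le (m + 1) (-1 : ZMod N)
  rw [show m + 1 + -1 = m by ring] at h
  exact h.trans ((Int.natAbs_add_le _ _).trans (by omega))

omit [NeZero N] in
/-- kernel: symmetrically `|vm(m + 1)| ≤ |vm m| + 1`. [cite: BalabanImbrieJaffe1985, p.326] -/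
theorem natAbs_valMinAbs_succ_le (hN : 3 ≤ N) (m : ZMod N) : (m + 1).valMinAbs.natAbs ≤ m.valMinAbs.natAbs + 1 := by
  have h1 : ((1 : ZMod N)).valMinAbs.natAbs ≤ 1 := by
    have : ((1 : ℕ) : ZMod N).valMinAbs = (1 : ℕ) := ZMod.valMinAbs_natCast_of_le_half (by omega)
    rw [Nat.cast_one] at this
    rw [this]; simp
  have h := ZMod.natAbs_valMinAbs_add_le m (1 : ZMod N)
  exact h.trans ((Int.natAbs_add_le _ _).trans (by omega))

/-- kernel: away from the antipode the least residue of `m + 1` is that of `m` plus one. [cite: BalabanImbrieJaffe1985, p.326] -/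
theorem valMinAbs_add_one {m : ZMod N} (h : 2 * m.valMinAbs.natAbs + 4 ≤ N) :
    (m + 1).valMinAbs = m.valMinAbs + 1 := by
  rw [ZMod.valMinAbs_spec]
  refine ⟨by rw [Int.cast_add, ZMod.coe_valMinAbs, Int.cast_one], ?_, ?_⟩
  · have : -(m.valMinAbs.natAbs : ℤ) ≤ m.valMinAbs := by omega
    omega
  · have : (m.valMinAbs : ℤ) ≤ m.valMinAbs.natAbs := by omega
    omega

/-- kernel: … and of `m − 1` minus one. [cite: BalabanImbrieJaffe1985, p.326] -/
theorem valMinAbs_sub_one {m : ZMod N} (h : 2 * m.valMinAbs.natAbs + 4 ≤ N) :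
    (m - 1).valMinAbs = m.valMinAbs - 1 := by
  rw [ZMod.valMinAbs_spec]
  refine ⟨by rw [Int.cast_sub, ZMod.coe_valMinAbs, Int.cast_one], ?_, ?_⟩
  · have : -(m.valMinAbs.natAbs : ℤ) ≤ m.valMinAbs := by omega
    omega
  · have : (m.valMinAbs : ℤ) ≤ m.valMinAbs.natAbs := by omega
    omega

/-- The tent around the circle: `T(m) = tent(|vm m|)` for `m ∈ ZMod N`. [folklore] -/
def tentC (r : ℕ) (m : ZMod N) : ℝ := tentZ r m.valMinAbs

omit [NeZero N] in
/-- kernel: `0 ≤ T ≤ 1`. [cite: BalabanImbrieJaffe1985, p.326] -/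
theorem tentC_nonneg (r : ℕ) (m : ZMod N) : 0 ≤ tentC r m := tentN_nonneg _ _

omit [NeZero N] in
/-- kernel: `T ≤ 1`. [cite: BalabanImbrieJaffe1985, p.326] -/
theorem tentC_le_one (hr : 1 ≤ r) (m : ZMod N) : tentC r m ≤ 1 := tentN_le_one hr _

/-- kernel: `T(m) ≠ 0 ⟹ cdist m < 2r`. [cite: BalabanImbrieJaffe1985, p.326] -/
theorem cdist_lt_of_tentC_ne_zero (hr : 1 ≤ r) {m : ZMod N} (h : tentC r m ≠ 0) : cdist m < 2 * r := by
  by_contra hc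
  rw [not_lt, ← natAbs_valMinAbs_eq_cdist] at hc
  exact h (tentN_of_ge hr hc)

/-- kernel: `T = 1` on the flat top `cdist m ≤ r`. [cite: BalabanImbrieJaffe1985, p.326] -/
theorem tentC_of_cdist_le {m : ZMod N} (h : cdist m ≤ r) : tentC r m = 1 := by
  unfold tentC tentZ; rw [natAbs_valMinAbs_eq_cdist]; exact tentN_of_le h

/-- kernel: **`1/r`-Lipschitz around the circle** (the tent support stays away from the antipode: `4r + 6 ≤ N`). [cite: BalabanImbrieJaffe1985, p.326] -/
theorem abs_tentC_succ_sub_le (hr : 1 ≤ r) (hN : 4 * r + 6 ≤ N) (m : ZMod N) : |tentC r (m + 1) - tentC r m| ≤ 1 / r := by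
  have hN3 : 3 ≤ N := by omega
  by_cases h : 2 * m.valMinAbs.natAbs + 4 ≤ N
  · unfold tentC; rw [valMinAbs_add_one h]; exact abs_tentZ_succ_sub_le hr _
  · -- near the antipode both values vanish
    have h0 : 2 * r ≤ m.valMinAbs.natAbs := by omega
    have h1 : 2 * r ≤ (m + 1).valMinAbs.natAbs := by have := natAbs_valMinAbs_le_succ hN3 m; omega
    unfold tentC tentZ
    rw [tentN_of_ge hr h0, tentN_of_ge hr h1, sub_self, abs_zero]; positivity

/-- kernel: **the second difference around the circle vanishes off the kinks** `cdist m ∈ {r, 2r}` (`4r + 6 ≤ N`). [cite: BalabanImbrieJaffe1985, p.326] -/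
theorem tentC_second_diff_eq_zero (hr : 1 ≤ r) (hN : 4 * r + 6 ≤ N) {m : ZMod N} (h1 : cdist m ≠ r) (h2 : cdist m ≠ 2 * r) :
    tentC r (m + 1) - 2 * tentC r m + tentC r (m - 1) = 0 := by
  have hN3 : 3 ≤ N := by omega
  rw [← natAbs_valMinAbs_eq_cdist] at h1 h2
  by_cases h : 2 * m.valMinAbs.natAbs + 4 ≤ N
  · unfold tentC; rw [valMinAbs_add_one h, valMinAbs_sub_one h]; exact tentZ_second_diff_eq_zero hr h1 h2
  · have h0 : 2 * r ≤ m.valMinAbs.natAbs := by omega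
    have ha : 2 * r ≤ (m + 1).valMinAbs.natAbs := by have := natAbs_valMinAbs_le_succ hN3 m; omega
    have hb : 2 * r ≤ (m - 1).valMinAbs.natAbs := by
      have := natAbs_valMinAbs_succ_le hN3 (m - 1); rw [sub_add_cancel] at this; omega
    unfold tentC tentZ
    rw [tentN_of_ge hr h0, tentN_of_ge hr ha, tentN_of_ge hr hb]; ring

/-- kernel: the second difference around the circle is at most `2/r` in size. [cite: BalabanImbrieJaffe1985, p.326] -/
theorem abs_tentC_second_diff_le (hr : 1 ≤ r) (hN : 4 * r + 6 ≤ N) (m : ZMod N) :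
    |tentC r (m + 1) - 2 * tentC r m + tentC r (m - 1)| ≤ 2 / r := by
  have e : tentC r (m + 1) - 2 * tentC r m + tentC r (m - 1) =
      (tentC r (m + 1) - tentC r m) - (tentC r (m - 1 + 1) - tentC r (m - 1)) := by rw [sub_add_cancel]; ring
  rw [e]
  refine (abs_sub _ _).trans ?_
  have := abs_tentC_succ_sub_le hr hN m
  have := abs_tentC_succ_sub_le hr hN (m - 1)
  have h2 : (2 : ℝ) / r = 1 / r + 1 / r := by ring
  linarith

/-- kernel: where the first difference of the circular tent is nonzero, the distance is at least `r − 1`. [cite: BalabanImbrieJaffe1985, p.326] -/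
theorem le_cdist_of_tentC_succ_ne (hr : 1 ≤ r) (hN : 4 * r + 6 ≤ N) {m : ZMod N} (h : tentC r (m + 1) ≠ tentC r m) :
    r ≤ cdist m + 1 := by
  have hN3 : 3 ≤ N := by omega
  by_contra hlt
  have hc : cdist m + 2 ≤ r := by omega
  have h0 : cdist m ≤ r := by omega
  have hc' : m.valMinAbs.natAbs + 2 ≤ r := by rw [natAbs_valMinAbs_eq_cdist]; exact hc
  have h1 : cdist (m + 1) ≤ r := by
    rw [← natAbs_valMinAbs_eq_cdist]
    have := natAbs_valMinAbs_succ_le hN3 m; omega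
  exact h (by rw [tentC_of_cdist_le h1, tentC_of_cdist_le h0])

end Tent

/-! ## §1b The product cutoff `χ_{y₀,r}(z) = ∏_ν T_r(z_ν − y₀,ν)` on the torus `T^{(j)}` -/

section Cutoff

variable {P : Params} {j : ℕ}

/-- kernel: `cdist` is symmetric in the difference. [cite: BalabanImbrieJaffe1985, p.326] -/
theorem cdist_sub_comm {n : ℕ} [NeZero n] (a b : ZMod n) : cdist (a - b) = cdist (b - a) := by
  rw [← neg_sub, cdist_neg]

/-- kernel: the `μ`-coordinate of `z + e_μ` is `z_μ + 1`, the others are unchanged. [cite: BalabanImbrieJaffe1985, p.326] -/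
theorem shift_apply_self' (z : Balaban1983to89.Site P j) (μ : Fin P.d) : z.shift μ μ = z μ + 1 := by
  simp [Balaban1983to89.Site.shift]

/-- kernel: the other coordinates of `z + e_μ` are those of `z`. [cite: BalabanImbrieJaffe1985, p.326] -/
theorem shift_apply_ne' (z : Balaban1983to89.Site P j) {μ ν : Fin P.d} (h : ν ≠ μ) : z.shift μ ν = z ν := by
  simp [Balaban1983to89.Site.shift, Function.update_of_ne h]

/-- kernel: the `μ`-coordinate of `z − e_μ` is `z_μ − 1`. [cite: BalabanImbrieJaffe1985, p.326] -/
theorem unshift_apply_self' (z : Balaban1983to89.Site P j) (μ : Fin P.d) : z.unshift μ μ = z μ - 1 := by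
  simp [Balaban1983to89.Site.unshift]

/-- kernel: the other coordinates of `z − e_μ` are those of `z`. [cite: BalabanImbrieJaffe1985, p.326] -/
theorem unshift_apply_ne' (z : Balaban1983to89.Site P j) {μ ν : Fin P.d} (h : ν ≠ μ) : z.unshift μ ν = z ν := by
  simp [Balaban1983to89.Site.unshift, Function.update_of_ne h]

/-- kernel: one lattice step moves the sup distance by at most one. [cite: BalabanImbrieJaffe1985, p.326] -/
theorem supDist_shift_le_one' (x : Balaban1983to89.Site P j) (μ : Fin P.d) : supDist x (x.shift μ) ≤ 1 := by
  rw [supDist_eq_sup_cdist]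
  refine Finset.sup_le fun ν _ => ?_
  by_cases hν : ν = μ
  · subst hν
    have h : x ν - x.shift ν ν = -1 := by rw [shift_apply_self']; ring
    rw [h, cdist_neg]
    exact (cdist_le_val _).trans (by rw [ZMod.val_one_eq_one_mod]; exact Nat.mod_le 1 _)
  · rw [shift_apply_ne' x hν, sub_self]
    exact (cdist_le_val _).trans (by simp)

/-- kernel: `|y₀ − (z+e_μ)|_∞ ≤ |y₀ − z|_∞ + 1`. [cite: BalabanImbrieJaffe1985, p.326] -/
theorem supDist_shift_le_succ (y₀ z : Balaban1983to89.Site P j) (μ : Fin P.d) : supDist y₀ (z.shift μ) ≤ supDist y₀ z + 1 :=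
  (supDist_triangle y₀ z (z.shift μ)).trans (Nat.add_le_add_left (supDist_shift_le_one' z μ) _)

/-- kernel: `|y₀ − z|_∞ ≤ |y₀ − (z+e_μ)|_∞ + 1`. [cite: BalabanImbrieJaffe1985, p.326] -/
theorem supDist_le_shift_succ (y₀ z : Balaban1983to89.Site P j) (μ : Fin P.d) : supDist y₀ z ≤ supDist y₀ (z.shift μ) + 1 := by
  have h := supDist_triangle y₀ (z.shift μ) z
  rw [supDist_comm (z.shift μ) z] at h
  exact h.trans (Nat.add_le_add_left (supDist_shift_le_one' z μ) _)

/-- kernel: `|y₀ − (z−e_μ)|_∞ ≤ |y₀ − z|_∞ + 1`. [cite: BalabanImbrieJaffe1985, p.326] -/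
theorem supDist_unshift_le_succ (y₀ z : Balaban1983to89.Site P j) (μ : Fin P.d) : supDist y₀ (z.unshift μ) ≤ supDist y₀ z + 1 := by
  have h := supDist_le_shift_succ y₀ (z.unshift μ) μ
  rwa [show (z.unshift μ).shift μ = z from (LatticeFieldCalculus.shiftEquiv μ).right_inv z] at h

/-- THE CUTOFF of the interior estimate: the product of circular tents of flat radius `r` in every coordinate around `y₀` — `1` on the
sup-ball of radius `r`, `0` off the sup-ball of radius `2r − 1`, `1/r`-Lipschitz along bonds, with second differences along bonds supported
on the two kink slabs `cdist(z_μ − y₀,μ) ∈ {r, 2r}`. [folklore] -/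
def chi (y₀ : Balaban1983to89.Site P j) (r : ℕ) (z : Balaban1983to89.Site P j) : ℝ := ∏ ν : Fin P.d, tentC r (z ν - y₀ ν)

variable {r : ℕ}

/-- kernel: `0 ≤ χ`. [cite: BalabanImbrieJaffe1985, p.326] -/
theorem chi_nonneg (y₀ : Balaban1983to89.Site P j) (r : ℕ) (z : Balaban1983to89.Site P j) : 0 ≤ chi y₀ r z :=
  Finset.prod_nonneg fun _ _ => tentC_nonneg _ _

/-- kernel: `χ ≤ 1`. [cite: BalabanImbrieJaffe1985, p.326] -/
theorem chi_le_one (hr : 1 ≤ r) (y₀ z : Balaban1983to89.Site P j) : chi y₀ r z ≤ 1 :=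
  Finset.prod_le_one (fun _ _ => tentC_nonneg _ _) fun _ _ => tentC_le_one hr _

/-- kernel: `|χ| ≤ 1`. [cite: BalabanImbrieJaffe1985, p.326] -/
theorem abs_chi_le_one (hr : 1 ≤ r) (y₀ z : Balaban1983to89.Site P j) : |chi y₀ r z| ≤ 1 := by
  rw [abs_of_nonneg (chi_nonneg y₀ r z)]; exact chi_le_one hr y₀ z

/-- kernel: `χ = 1` on the ball `|y₀ − z|_∞ ≤ r`. [cite: BalabanImbrieJaffe1985, p.326] -/
theorem chi_eq_one_of_supDist_le {y₀ z : Balaban1983to89.Site P j} (h : supDist y₀ z ≤ r) : chi y₀ r z = 1 :=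
  Finset.prod_eq_one fun ν _ => tentC_of_cdist_le (by rw [cdist_sub_comm]; exact (cdist_le_supDist y₀ z ν).trans h)

/-- kernel: `χ(z) ≠ 0 ⟹ |y₀ − z|_∞ < 2r`. [cite: BalabanImbrieJaffe1985, p.326] -/
theorem supDist_lt_of_chi_ne_zero (hr : 1 ≤ r) {y₀ z : Balaban1983to89.Site P j} (h : chi y₀ r z ≠ 0) : supDist y₀ z < 2 * r := by
  rw [supDist_eq_sup_cdist, Finset.sup_lt_iff (by exact_mod_cast (show 0 < 2 * r by omega))]
  intro ν _
  rw [← cdist_sub_comm]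
  exact cdist_lt_of_tentC_ne_zero hr (Finset.prod_ne_zero_iff.1 h ν (Finset.mem_univ ν))

/-- kernel: the bond difference of `χ` factorises through the tent difference in the bond direction. [cite: BalabanImbrieJaffe1985, p.326] -/
theorem chi_shift_sub (y₀ z : Balaban1983to89.Site P j) (μ : Fin P.d) :
    chi y₀ r (z.shift μ) - chi y₀ r z =
      (tentC r (z μ - y₀ μ + 1) - tentC r (z μ - y₀ μ)) * ∏ ν ∈ univ.erase μ, tentC r (z ν - y₀ ν) := by
  unfold chi
  rw [← Finset.mul_prod_erase univ _ (Finset.mem_univ μ), ← Finset.mul_prod_erase univ _ (Finset.mem_univ μ), shift_apply_self',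
    show z μ + 1 - y₀ μ = z μ - y₀ μ + 1 by ring]
  have he : ∏ ν ∈ univ.erase μ, tentC r (z.shift μ ν - y₀ ν) = ∏ ν ∈ univ.erase μ, tentC r (z ν - y₀ ν) :=
    Finset.prod_congr rfl fun ν hν => by rw [shift_apply_ne' z (Finset.ne_of_mem_erase hν)]
  rw [he]; ring

/-- kernel: the second bond difference of `χ` factorises through the second tent difference. [cite: BalabanImbrieJaffe1985, p.326] -/
theorem chi_second_diff (y₀ z : Balaban1983to89.Site P j) (μ : Fin P.d) :
    chi y₀ r (z.shift μ) - 2 * chi y₀ r z + chi y₀ r (z.unshift μ) =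
      (tentC r (z μ - y₀ μ + 1) - 2 * tentC r (z μ - y₀ μ) + tentC r (z μ - y₀ μ - 1)) *
        ∏ ν ∈ univ.erase μ, tentC r (z ν - y₀ ν) := by
  unfold chi
  rw [← Finset.mul_prod_erase univ _ (Finset.mem_univ μ), ← Finset.mul_prod_erase univ (fun ν => tentC r (z ν - y₀ ν)) (Finset.mem_univ μ),
    ← Finset.mul_prod_erase univ (fun ν => tentC r (z.unshift μ ν - y₀ ν)) (Finset.mem_univ μ), shift_apply_self',
    unshift_apply_self', show z μ + 1 - y₀ μ = z μ - y₀ μ + 1 by ring, show z μ - 1 - y₀ μ = z μ - y₀ μ - 1 by ring]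
  have he : ∏ ν ∈ univ.erase μ, tentC r (z.shift μ ν - y₀ ν) = ∏ ν ∈ univ.erase μ, tentC r (z ν - y₀ ν) :=
    Finset.prod_congr rfl fun ν hν => by rw [shift_apply_ne' z (Finset.ne_of_mem_erase hν)]
  have he' : ∏ ν ∈ univ.erase μ, tentC r (z.unshift μ ν - y₀ ν) = ∏ ν ∈ univ.erase μ, tentC r (z ν - y₀ ν) :=
    Finset.prod_congr rfl fun ν hν => by rw [unshift_apply_ne' z (Finset.ne_of_mem_erase hν)]
  rw [he, he']; ring

/-- kernel: the co-factor is in `[0, 1]`. [cite: BalabanImbrieJaffe1985, p.326] -/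
theorem abs_prod_erase_le_one (hr : 1 ≤ r) (y₀ z : Balaban1983to89.Site P j) (μ : Fin P.d) :
    |∏ ν ∈ univ.erase μ, tentC r (z ν - y₀ ν)| ≤ 1 := by
  rw [abs_of_nonneg (Finset.prod_nonneg fun _ _ => tentC_nonneg _ _)]
  exact Finset.prod_le_one (fun _ _ => tentC_nonneg _ _) fun _ _ => tentC_le_one hr _

/-- **`χ` IS `1/r`-LIPSCHITZ ALONG BONDS**: `|χ(z+e_μ) − χ(z)| ≤ 1/r` (`4r + 6 ≤ sitesPerDir`). [cite: BalabanImbrieJaffe1985, p.326] -/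
theorem abs_chi_shift_sub_le (hr : 1 ≤ r) (hN : 4 * r + 6 ≤ P.sitesPerDir j) (y₀ z : Balaban1983to89.Site P j) (μ : Fin P.d) :
    |chi y₀ r (z.shift μ) - chi y₀ r z| ≤ 1 / r := by
  rw [chi_shift_sub, abs_mul]
  have h1 := abs_tentC_succ_sub_le hr hN (z μ - y₀ μ)
  have h2 := abs_prod_erase_le_one hr y₀ z μ
  have : (0 : ℝ) ≤ 1 / r := by positivity
  nlinarith [abs_nonneg (tentC r (z μ - y₀ μ + 1) - tentC r (z μ - y₀ μ)), abs_nonneg (∏ ν ∈ univ.erase μ, tentC r (z ν - y₀ ν))]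

/-- kernel: where the bond difference of `χ` is nonzero, `r ≤ |y₀ − z|_∞ + 1` … [cite: BalabanImbrieJaffe1985, p.326] -/
theorem le_supDist_of_chi_shift_ne (hr : 1 ≤ r) (hN : 4 * r + 6 ≤ P.sitesPerDir j) {y₀ z : Balaban1983to89.Site P j} {μ : Fin P.d}
    (h : chi y₀ r (z.shift μ) ≠ chi y₀ r z) : r ≤ supDist y₀ z + 1 := by
  have h' : tentC r (z μ - y₀ μ + 1) ≠ tentC r (z μ - y₀ μ) := by
    intro he
    apply h
    have := chi_shift_sub y₀ z μ (r := r)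
    rw [he, sub_self, zero_mul] at this
    linarith
  have h1 := le_cdist_of_tentC_succ_ne hr hN h'
  have h2 : cdist (z μ - y₀ μ) ≤ supDist y₀ z := by rw [cdist_sub_comm]; exact cdist_le_supDist y₀ z μ
  omega

/-- kernel: … and `|y₀ − z|_∞ ≤ 2r`. [cite: BalabanImbrieJaffe1985, p.326] -/
theorem supDist_le_of_chi_shift_ne (hr : 1 ≤ r) {y₀ z : Balaban1983to89.Site P j} {μ : Fin P.d}
    (h : chi y₀ r (z.shift μ) ≠ chi y₀ r z) : supDist y₀ z ≤ 2 * r := by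
  by_cases h0 : chi y₀ r z = 0
  · have h1 : chi y₀ r (z.shift μ) ≠ 0 := by rw [h0] at h; exact h
    have := supDist_lt_of_chi_ne_zero hr h1
    have := supDist_le_shift_succ y₀ z μ
    omega
  · have := supDist_lt_of_chi_ne_zero hr h0; omega

/-- **THE SECOND BOND DIFFERENCE OF `χ` IS AT MOST `2/r`**. [cite: BalabanImbrieJaffe1985, p.326] -/
theorem abs_chi_second_diff_le (hr : 1 ≤ r) (hN : 4 * r + 6 ≤ P.sitesPerDir j) (y₀ z : Balaban1983to89.Site P j) (μ : Fin P.d) :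
    |chi y₀ r (z.shift μ) - 2 * chi y₀ r z + chi y₀ r (z.unshift μ)| ≤ 2 / r := by
  rw [chi_second_diff, abs_mul]
  have h1 := abs_tentC_second_diff_le hr hN (z μ - y₀ μ)
  have h2 := abs_prod_erase_le_one hr y₀ z μ
  have : (0 : ℝ) ≤ 2 / r := by positivity
  nlinarith [abs_nonneg (tentC r (z μ - y₀ μ + 1) - 2 * tentC r (z μ - y₀ μ) + tentC r (z μ - y₀ μ - 1)),
    abs_nonneg (∏ ν ∈ univ.erase μ, tentC r (z ν - y₀ ν))]

/-- **… AND IT IS SUPPORTED ON THE TWO KINK SLABS** `cdist(z_μ − y₀,μ) ∈ {r, 2r}`. [cite: BalabanImbrieJaffe1985, p.326] -/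
theorem cdist_eq_of_chi_second_diff_ne_zero (hr : 1 ≤ r) (hN : 4 * r + 6 ≤ P.sitesPerDir j) {y₀ z : Balaban1983to89.Site P j}
    {μ : Fin P.d} (h : chi y₀ r (z.shift μ) - 2 * chi y₀ r z + chi y₀ r (z.unshift μ) ≠ 0) :
    cdist (z μ - y₀ μ) = r ∨ cdist (z μ - y₀ μ) = 2 * r := by
  by_contra hc
  rw [not_or] at hc
  apply h
  rw [chi_second_diff, tentC_second_diff_eq_zero hr hN hc.1 hc.2, zero_mul]

/-- kernel: … inside the ball `|y₀ − z|_∞ ≤ 2r`. [cite: BalabanImbrieJaffe1985, p.326] -/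
theorem supDist_le_of_chi_second_diff_ne_zero (hr : 1 ≤ r) {y₀ z : Balaban1983to89.Site P j} {μ : Fin P.d}
    (h : chi y₀ r (z.shift μ) - 2 * chi y₀ r z + chi y₀ r (z.unshift μ) ≠ 0) : supDist y₀ z ≤ 2 * r := by
  by_contra hz
  apply h
  have h0 : chi y₀ r z = 0 := by
    by_contra h0; have := supDist_lt_of_chi_ne_zero hr h0; omega
  have h1 : chi y₀ r (z.shift μ) = 0 := by
    by_contra h1; have := supDist_lt_of_chi_ne_zero hr h1; have := supDist_le_shift_succ y₀ z μ; omega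
  have h2 : chi y₀ r (z.unshift μ) = 0 := by
    by_contra h2
    have := supDist_lt_of_chi_ne_zero hr h2
    have h3 := supDist_shift_le_succ y₀ (z.unshift μ) μ
    rw [show (z.unshift μ).shift μ = z from (LatticeFieldCalculus.shiftEquiv μ).right_inv z] at h3
    omega
  rw [h0, h1, h2]; ring

end Cutoff

/-! ## §2 Lattice counting: sup-balls and coordinate slabs of the torus -/

section Counting

variable {P : Params} {j : ℕ}

/-- The sup-ball `{z : |y₀ − z|_∞ ≤ n}` as a finset. [folklore] -/
def ball (y₀ : Balaban1983to89.Site P j) (n : ℕ) : Finset (Balaban1983to89.Site P j) := univ.filter fun z => supDist y₀ z ≤ n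

/-- The slab of the ball with the `μ`-th circular coordinate distance equal to `s`. [folklore] -/
def slab (y₀ : Balaban1983to89.Site P j) (n : ℕ) (μ : Fin P.d) (s : ℕ) : Finset (Balaban1983to89.Site P j) :=
  univ.filter fun z => supDist y₀ z ≤ n ∧ cdist (z μ - y₀ μ) = s

/-- kernel: membership in the ball. [cite: BalabanImbrieJaffe1985, p.326] -/
theorem mem_ball {y₀ z : Balaban1983to89.Site P j} {n : ℕ} : z ∈ ball y₀ n ↔ supDist y₀ z ≤ n := by
  simp [ball]

/-- kernel: membership in a slab. [cite: BalabanImbrieJaffe1985, p.326] -/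
theorem mem_slab {y₀ z : Balaban1983to89.Site P j} {n : ℕ} {μ : Fin P.d} {s : ℕ} :
    z ∈ slab y₀ n μ s ↔ supDist y₀ z ≤ n ∧ cdist (z μ - y₀ μ) = s := by
  simp [slab]

/-- kernel: translating a coordinate condition does not change the count (bound form). [cite: BalabanImbrieJaffe1985, p.326] -/
theorem card_filter_sub_right_le {n : ℕ} [NeZero n] (c : ZMod n) (p : ZMod n → Prop) [DecidablePred p] :
    (univ.filter fun m : ZMod n => p (m - c)).card ≤ (univ.filter p).card := by
  calc (univ.filter fun m : ZMod n => p (m - c)).card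
      ≤ ((univ.filter p).image fun m => m + c).card := by
        refine Finset.card_le_card fun m hm => ?_
        rw [Finset.mem_filter] at hm
        exact Finset.mem_image.mpr ⟨m - c, Finset.mem_filter.mpr ⟨Finset.mem_univ _, hm.2⟩, sub_add_cancel m c⟩
    _ ≤ _ := Finset.card_image_le

/-- **BALL COUNT**: `#{z : |y₀ − z|_∞ ≤ n} ≤ (2n + 1)^d`. [cite: BalabanImbrieJaffe1985, p.326] -/
theorem card_ball_le (y₀ : Balaban1983to89.Site P j) (n : ℕ) : (ball y₀ n).card ≤ (2 * n + 1) ^ P.d := by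
  classical
  set B : Fin P.d → Finset (ZMod (P.sitesPerDir j)) := fun ν => univ.filter fun m => cdist (m - y₀ ν) ≤ n with hB
  have hsub : ball y₀ n ⊆ Fintype.piFinset B := by
    intro z hz
    rw [mem_ball] at hz
    refine Fintype.mem_piFinset.mpr fun ν => Finset.mem_filter.mpr ⟨Finset.mem_univ _, ?_⟩
    rw [cdist_sub_comm]; exact (cdist_le_supDist y₀ z ν).trans hz
  refine (Finset.card_le_card hsub).trans ?_
  refine (Fintype.card_piFinset B).le.trans ?_
  calc ∏ ν, (B ν).card ≤ ∏ _ν : Fin P.d, (2 * n + 1) :=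
        Finset.prod_le_prod (fun _ _ => Nat.zero_le _) fun ν _ =>
          (card_filter_sub_right_le (y₀ ν) (fun m => cdist m ≤ n)).trans (card_cdist_le_le n)
    _ = (2 * n + 1) ^ P.d := by rw [Finset.prod_const, Finset.card_univ, Fintype.card_fin]

/-- **SLAB COUNT**: `#{z : |y₀ − z|_∞ ≤ n, cdist(z_μ − y₀,μ) = s} ≤ 2(2n + 1)^{d−1}`. [cite: BalabanImbrieJaffe1985, p.326] -/
theorem card_slab_le (y₀ : Balaban1983to89.Site P j) (n : ℕ) (μ : Fin P.d) (s : ℕ) :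
    (slab y₀ n μ s).card ≤ 2 * (2 * n + 1) ^ (P.d - 1) := by
  classical
  set B : Fin P.d → Finset (ZMod (P.sitesPerDir j)) := fun ν =>
    if ν = μ then univ.filter fun m => cdist (m - y₀ ν) = s else univ.filter fun m => cdist (m - y₀ ν) ≤ n with hB
  have hsub : slab y₀ n μ s ⊆ Fintype.piFinset B := by
    intro z hz
    rw [mem_slab] at hz
    refine Fintype.mem_piFinset.mpr fun ν => ?_
    by_cases hν : ν = μ
    · subst hν; simp only [hB, if_true]; exact Finset.mem_filter.mpr ⟨Finset.mem_univ _, hz.2⟩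
    · simp only [hB, hν, if_false]
      refine Finset.mem_filter.mpr ⟨Finset.mem_univ _, ?_⟩
      rw [cdist_sub_comm]; exact (cdist_le_supDist y₀ z ν).trans hz.1
  refine (Finset.card_le_card hsub).trans ?_
  refine (Fintype.card_piFinset B).le.trans ?_
  have hμ : (B μ).card ≤ 2 := by
    simp only [hB, if_true]
    exact (card_filter_sub_right_le (y₀ μ) (fun m => cdist m = s)).trans (card_cdist_eq_le s)
  have hν : ∀ ν ∈ univ.erase μ, (B ν).card ≤ 2 * n + 1 := by
    intro ν hν
    have hne : ν ≠ μ := Finset.ne_of_mem_erase hν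
    simp only [hB, hne, if_false]
    exact (card_filter_sub_right_le (y₀ ν) (fun m => cdist m ≤ n)).trans (card_cdist_le_le n)
  rw [← Finset.mul_prod_erase univ (fun ν => (B ν).card) (Finset.mem_univ μ)]
  refine Nat.mul_le_mul hμ ?_
  calc ∏ ν ∈ univ.erase μ, (B ν).card ≤ ∏ _ν ∈ univ.erase μ, (2 * n + 1) :=
        Finset.prod_le_prod (fun _ _ => Nat.zero_le _) hν
    _ = (2 * n + 1) ^ (P.d - 1) := by
        rw [Finset.prod_const, Finset.card_erase_of_mem (Finset.mem_univ μ), Finset.card_univ, Fintype.card_fin]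

end Counting

/-! ## §3 Radial profiles: sums over the torus of functions dominated by a profile of the sup distance -/

section Radial

variable {P : Params} {j : ℕ}

/-- kernel: the shell of radius `0` is the centre. [cite: BalabanImbrieJaffe1985, p.326] -/
theorem shell_zero (y₀ : Balaban1983to89.Site P j) : shell y₀ 0 = {y₀} := by
  ext z
  simp only [shell, Finset.mem_filter, Finset.mem_univ, true_and, Finset.mem_singleton, supDist_eq_zero_iff]
  exact eq_comm

/-- **SHELL-BY-SHELL BOUND**: a function `g ≤ F(|y₀ − z|_∞)` on the ball of radius `n`, `≤ 0` outside, `F ≥ 0`, has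
`Σ_z g(z) ≤ F(0) + Σ_{s=1}^{n} 2d(2s+1)^{d−1}F(s)`. [cite: BalabanImbrieJaffe1985, p.326] -/
theorem sum_le_radial (y₀ : Balaban1983to89.Site P j) (n : ℕ) (Fb : ℕ → ℝ) (hFb : ∀ s, 0 ≤ Fb s) (g : Balaban1983to89.Site P j → ℝ)
    (hg : ∀ z, supDist y₀ z ≤ n → g z ≤ Fb (supDist y₀ z)) (hg' : ∀ z, n < supDist y₀ z → g z ≤ 0) :
    ∑ z, g z ≤ Fb 0 + ∑ i ∈ Finset.range n, 2 * P.d * (2 * ((i + 1 : ℕ) : ℝ) + 1) ^ (P.d - 1) * Fb (i + 1) := by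
  classical
  have h1 : ∑ z, g z ≤ ∑ z, (if supDist y₀ z ≤ n then Fb (supDist y₀ z) else 0) := by
    refine Finset.sum_le_sum fun z _ => ?_
    split_ifs with h
    · exact hg z h
    · exact hg' z (not_le.mp h)
  refine h1.trans ?_
  rw [← Finset.sum_filter]
  have hmaps : ∀ z ∈ univ.filter (fun z : Balaban1983to89.Site P j => supDist y₀ z ≤ n), supDist y₀ z ∈ Finset.range (n + 1) := by
    intro z hz; rw [Finset.mem_filter] at hz; rw [Finset.mem_range]; omega
  rw [← Finset.sum_fiberwise_of_maps_to hmaps]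
  have hfib : ∀ s ∈ Finset.range (n + 1),
      ∑ z ∈ (univ.filter fun z : Balaban1983to89.Site P j => supDist y₀ z ≤ n).filter (fun z => supDist y₀ z = s),
        Fb (supDist y₀ z) = (shell y₀ s).card * Fb s := by
    intro s hs
    rw [Finset.mem_range] at hs
    have hset : (univ.filter fun z : Balaban1983to89.Site P j => supDist y₀ z ≤ n).filter (fun z => supDist y₀ z = s) = shell y₀ s := by
      ext z
      simp only [Finset.mem_filter, Finset.mem_univ, true_and, shell]
      constructor
      · exact fun h => h.2
      · intro h; exact ⟨by omega, h⟩
    rw [hset]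
    have h2 : ∑ z ∈ shell y₀ s, Fb (supDist y₀ z) = ∑ z ∈ shell y₀ s, Fb s :=
      Finset.sum_congr rfl fun z hz => by
        have hz' : supDist y₀ z = s := by simp only [shell, Finset.mem_filter, Finset.mem_univ, true_and] at hz; exact hz
        rw [hz']
    rw [h2, Finset.sum_const, nsmul_eq_mul]
  rw [Finset.sum_congr rfl hfib, Finset.sum_range_succ', shell_zero, Finset.card_singleton, Nat.cast_one, one_mul]
  have key : ∑ i ∈ Finset.range n, ((shell y₀ (i + 1)).card : ℝ) * Fb (i + 1)
      ≤ ∑ i ∈ Finset.range n, 2 * P.d * (2 * ((i + 1 : ℕ) : ℝ) + 1) ^ (P.d - 1) * Fb (i + 1) :=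
    Finset.sum_le_sum fun i _ => mul_le_mul_of_nonneg_right (card_shell_le y₀ (s := i + 1) (by omega)) (hFb _)
  linarith

/-- kernel: `(2s+1)^{d−1} ≤ 3^{d−1}s^{d−1}` for `s ≥ 1`. [cite: BalabanImbrieJaffe1985, p.326] -/
theorem shellFactor_le {s : ℝ} (hs : 1 ≤ s) (e : ℕ) : (2 * s + 1) ^ e ≤ 3 ^ e * s ^ e := by
  rw [← mul_pow]; exact pow_le_pow_left₀ (by linarith) (by linarith) e

/-- **PROFILE `1/max(s,1)^{d−1}`**: `Σ_{s=1}^{n} 2d(2s+1)^{d−1}·(A/s^{d−1}) ≤ 2d·3^{d−1}·A·n` (`A ≥ 0`). [cite: BalabanImbrieJaffe1985, p.326] -/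
theorem radial_sum_inv_pow_le (hd : 1 ≤ P.d) {A : ℝ} (hA : 0 ≤ A) (n : ℕ) :
    ∑ i ∈ Finset.range n, 2 * P.d * (2 * ((i + 1 : ℕ) : ℝ) + 1) ^ (P.d - 1) * (A / ((i + 1 : ℕ) : ℝ) ^ (P.d - 1))
      ≤ 2 * P.d * 3 ^ (P.d - 1) * A * n := by
  have hterm : ∀ i ∈ Finset.range n,
      2 * P.d * (2 * ((i + 1 : ℕ) : ℝ) + 1) ^ (P.d - 1) * (A / ((i + 1 : ℕ) : ℝ) ^ (P.d - 1)) ≤ 2 * P.d * 3 ^ (P.d - 1) * A := by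
    intro i _
    have hs : (1 : ℝ) ≤ ((i + 1 : ℕ) : ℝ) := by exact_mod_cast Nat.succ_pos i
    have hsp : (0 : ℝ) < ((i + 1 : ℕ) : ℝ) ^ (P.d - 1) := by positivity
    have h1 := shellFactor_le hs (P.d - 1)
    calc 2 * (P.d : ℝ) * (2 * ((i + 1 : ℕ) : ℝ) + 1) ^ (P.d - 1) * (A / ((i + 1 : ℕ) : ℝ) ^ (P.d - 1))
        ≤ 2 * P.d * (3 ^ (P.d - 1) * ((i + 1 : ℕ) : ℝ) ^ (P.d - 1)) * (A / ((i + 1 : ℕ) : ℝ) ^ (P.d - 1)) := by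
          gcongr
      _ = 2 * P.d * 3 ^ (P.d - 1) * A := by field_simp
  calc _ ≤ ∑ _i ∈ Finset.range n, 2 * (P.d : ℝ) * 3 ^ (P.d - 1) * A := Finset.sum_le_sum hterm
    _ = 2 * P.d * 3 ^ (P.d - 1) * A * n := by rw [Finset.sum_const, Finset.card_range, nsmul_eq_mul]; ring

/-- **PROFILE `s/max(s,1)^{d−1}`**: `Σ_{s=1}^{n} 2d(2s+1)^{d−1}·(A·s/s^{d−1}) ≤ 2d·3^{d−1}·A·n²` (`A ≥ 0`). [cite: BalabanImbrieJaffe1985, p.326] -/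
theorem radial_sum_mul_inv_pow_le (hd : 1 ≤ P.d) {A : ℝ} (hA : 0 ≤ A) (n : ℕ) :
    ∑ i ∈ Finset.range n, 2 * P.d * (2 * ((i + 1 : ℕ) : ℝ) + 1) ^ (P.d - 1) * (A * ((i + 1 : ℕ) : ℝ) / ((i + 1 : ℕ) : ℝ) ^ (P.d - 1))
      ≤ 2 * P.d * 3 ^ (P.d - 1) * A * n ^ 2 := by
  have hterm : ∀ i ∈ Finset.range n,
      2 * P.d * (2 * ((i + 1 : ℕ) : ℝ) + 1) ^ (P.d - 1) * (A * ((i + 1 : ℕ) : ℝ) / ((i + 1 : ℕ) : ℝ) ^ (P.d - 1))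
        ≤ 2 * P.d * 3 ^ (P.d - 1) * A * n := by
    intro i hi
    rw [Finset.mem_range] at hi
    have hs : (1 : ℝ) ≤ ((i + 1 : ℕ) : ℝ) := by exact_mod_cast Nat.succ_pos i
    have hsn : ((i + 1 : ℕ) : ℝ) ≤ n := by exact_mod_cast hi
    have hsp : (0 : ℝ) < ((i + 1 : ℕ) : ℝ) ^ (P.d - 1) := by positivity
    have h1 := shellFactor_le hs (P.d - 1)
    calc 2 * (P.d : ℝ) * (2 * ((i + 1 : ℕ) : ℝ) + 1) ^ (P.d - 1) * (A * ((i + 1 : ℕ) : ℝ) / ((i + 1 : ℕ) : ℝ) ^ (P.d - 1))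
        ≤ 2 * P.d * (3 ^ (P.d - 1) * ((i + 1 : ℕ) : ℝ) ^ (P.d - 1)) * (A * n / ((i + 1 : ℕ) : ℝ) ^ (P.d - 1)) := by
          gcongr
      _ = 2 * P.d * 3 ^ (P.d - 1) * A * n := by field_simp
  calc _ ≤ ∑ _i ∈ Finset.range n, 2 * (P.d : ℝ) * 3 ^ (P.d - 1) * A * n := Finset.sum_le_sum hterm
    _ = 2 * P.d * 3 ^ (P.d - 1) * A * n ^ 2 := by rw [Finset.sum_const, Finset.card_range, nsmul_eq_mul]; ring

end Radial

/-! ## §4 Envelope helpers: neighbour and far envelopes, radial bounds for the two integer profiles -/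

section Helpers

/-- kernel: **neighbour envelope** — if `T ≤ T′ + 1` then `A/max(T′,1)^p ≤ 2^pA/max(T,1)^p` (`A ≥ 0`). [cite: BalabanImbrieJaffe1985, p.326] -/
theorem env_neighbour {T T' : ℕ} (h : T ≤ T' + 1) (p : ℕ) {A : ℝ} (hA : 0 ≤ A) :
    A / (max (T' : ℝ) 1) ^ p ≤ 2 ^ p * A / (max (T : ℝ) 1) ^ p := by
  have h1 : max (T : ℝ) 1 ≤ 2 * max (T' : ℝ) 1 := by
    have hT : (T : ℝ) ≤ T' + 1 := by exact_mod_cast h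
    refine max_le ?_ ?_
    · have := le_max_left (T' : ℝ) 1; have := le_max_right (T' : ℝ) 1; linarith
    · have := le_max_right (T' : ℝ) 1; linarith
  have hm : 0 < max (T : ℝ) 1 := lt_max_of_lt_right one_pos
  have hm' : 0 < max (T' : ℝ) 1 := lt_max_of_lt_right one_pos
  rw [le_div_iff₀ (pow_pos hm _), div_mul_eq_mul_div, div_le_iff₀ (pow_pos hm' _)]
  calc A * (max (T : ℝ) 1) ^ p ≤ A * (2 * max (T' : ℝ) 1) ^ p :=
        mul_le_mul_of_nonneg_left (pow_le_pow_left₀ hm.le h1 p) hA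
    _ = 2 ^ p * A * (max (T' : ℝ) 1) ^ p := by rw [mul_pow]; ring

/-- kernel: **far envelope** — if `ρ/2 ≤ T` (`ρ > 0`) then `A/max(T,1)^p ≤ A(2/ρ)^p` (`A ≥ 0`). [cite: BalabanImbrieJaffe1985, p.326] -/
theorem env_far {T : ℕ} {ρ : ℝ} (hρ : 0 < ρ) (h : ρ / 2 ≤ (T : ℝ)) (p : ℕ) {A : ℝ} (hA : 0 ≤ A) :
    A / (max (T : ℝ) 1) ^ p ≤ A * (2 / ρ) ^ p := by
  have hm : ρ / 2 ≤ max (T : ℝ) 1 := h.trans (le_max_left _ _)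
  have hm0 : 0 < max (T : ℝ) 1 := lt_max_of_lt_right one_pos
  rw [div_eq_mul_inv, ← inv_pow]
  refine mul_le_mul_of_nonneg_left (pow_le_pow_left₀ (inv_nonneg.2 hm0.le) ?_ p) hA
  rw [inv_le_comm₀ hm0 (by positivity), inv_div]; exact hm

/-- kernel: on a shell of radius `s ≥ 1` the envelope `max(s,1)` is `s`. [cite: BalabanImbrieJaffe1985, p.326] -/
theorem max_cast_succ (i : ℕ) : max (((i + 1 : ℕ) : ℝ)) 1 = ((i + 1 : ℕ) : ℝ) :=
  max_eq_left (by exact_mod_cast Nat.succ_pos i)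

variable {P : Params}

/-- **RADIAL BOUND, PROFILE `A/max(T,1)^{d−1}`**: a real function `g ≤ A/max(|y₀−z|_∞,1)^{d−1}` on the ball of radius `n` and `≤ 0`
outside has `Σ_z g(z) ≤ A(1 + 2d3^{d−1}n)`. [cite: BalabanImbrieJaffe1985, p.326] -/
theorem radial_env_one (hd : 1 ≤ P.d) (y₀ : Balaban1983to89.Site P 0) (n : ℕ) {A : ℝ} (hA : 0 ≤ A) (g : Balaban1983to89.Site P 0 → ℝ)
    (hg : ∀ z, supDist y₀ z ≤ n → g z ≤ A / (max (supDist y₀ z : ℝ) 1) ^ (P.d - 1)) (hg' : ∀ z, n < supDist y₀ z → g z ≤ 0) :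
    ∑ z, g z ≤ A * (1 + 2 * P.d * 3 ^ (P.d - 1) * n) := by
  have h := sum_le_radial y₀ n (fun s => A / (max (s : ℝ) 1) ^ (P.d - 1)) (fun s => by positivity) g hg hg'
  refine h.trans ?_
  simp only [Nat.cast_zero]
  rw [max_eq_right (zero_le_one' ℝ), one_pow, div_one]
  have h2 := radial_sum_inv_pow_le hd hA n
  simp only [max_cast_succ]
  linarith [h2]

/-- **RADIAL BOUND, PROFILE `A·T/max(T,1)^{d−1}`**: `Σ_z g(z) ≤ 2d3^{d−1}An²`. [cite: Balaban1983RegularityDecay, (1.9) p.573] -/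
theorem radial_env_T (hd : 1 ≤ P.d) (y₀ : Balaban1983to89.Site P 0) (n : ℕ) {A : ℝ} (hA : 0 ≤ A) (g : Balaban1983to89.Site P 0 → ℝ)
    (hg : ∀ z, supDist y₀ z ≤ n → g z ≤ A * (supDist y₀ z : ℝ) / (max (supDist y₀ z : ℝ) 1) ^ (P.d - 1))
    (hg' : ∀ z, n < supDist y₀ z → g z ≤ 0) :
    ∑ z, g z ≤ 2 * P.d * 3 ^ (P.d - 1) * A * n ^ 2 := by
  have h := sum_le_radial y₀ n (fun s => A * (s : ℝ) / (max (s : ℝ) 1) ^ (P.d - 1)) (fun s => by positivity) g hg hg'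
  refine h.trans ?_
  simp only [Nat.cast_zero, mul_zero, zero_div, zero_add]
  have h2 := radial_sum_mul_inv_pow_le hd hA n
  simp only [max_cast_succ]
  exact h2

end Helpers

/-! ## §5 Real-exponent radial sums (the Hölder envelopes `ρ^α/max(T,1)^{d−1+α}`, `ρ^α/max(T,1)^{d+α}`) -/

section RealRadial

/-- kernel: **Bernoulli, concave case** — `(1−β)s^{−β} ≤ s^{1−β} − (s−1)^{1−β}` for `s ≥ 1`, `0 ≤ β ≤ 1`. [cite: Balaban1983RegularityDecay, (1.9) p.573] -/
theorem rpow_neg_le_sub {s β : ℝ} (hs : 1 ≤ s) (hβ0 : 0 ≤ β) (hβ1 : β ≤ 1) :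
    (1 - β) * s ^ (-β) ≤ s ^ (1 - β) - (s - 1) ^ (1 - β) := by
  have hs0 : 0 < s := by linarith
  have hb : (1 + (-1 / s)) ^ (1 - β) ≤ 1 + (1 - β) * (-1 / s) :=
    rpow_one_add_le_one_add_mul_self (by rw [neg_div, neg_le_neg_iff]; exact (div_le_one hs0).2 hs) (by linarith) (by linarith)
  have hsplit : (s - 1) ^ (1 - β) = s ^ (1 - β) * (1 + (-1 / s)) ^ (1 - β) := by
    rw [← Real.mul_rpow hs0.le (by rw [neg_div, ← sub_eq_add_neg, sub_nonneg]; exact (div_le_one hs0).2 hs)]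
    congr 1
    field_simp; ring
  have hpow : s ^ (1 - β) * (1 / s) = s ^ (-β) := by
    rw [one_div, ← Real.rpow_neg_one, ← Real.rpow_add hs0]
    congr 1; ring
  have hsp : 0 ≤ s ^ (1 - β) := Real.rpow_nonneg hs0.le _
  calc (1 - β) * s ^ (-β) = s ^ (1 - β) - s ^ (1 - β) * (1 + (1 - β) * (-1 / s)) := by rw [← hpow]; ring
    _ ≤ s ^ (1 - β) - s ^ (1 - β) * (1 + (-1 / s)) ^ (1 - β) := by
        have := mul_le_mul_of_nonneg_left hb hsp; linarith
    _ = s ^ (1 - β) - (s - 1) ^ (1 - β) := by rw [hsplit]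

/-- **THE REAL-EXPONENT SUM `Σ_{s=1}^{n} s^{−β} ≤ n^{1−β}/(1−β)`** (`0 ≤ β < 1`; telescoping `rpow_neg_le_sub`). [cite: Balaban1983RegularityDecay, (1.9) p.573] -/
theorem sum_rpow_neg_le {β : ℝ} (hβ0 : 0 ≤ β) (hβ1 : β < 1) (n : ℕ) :
    ∑ i ∈ Finset.range n, (((i + 1 : ℕ) : ℝ)) ^ (-β) ≤ (n : ℝ) ^ (1 - β) / (1 - β) := by
  have h1 : 0 < 1 - β := by linarith
  rw [le_div_iff₀ h1]
  induction n with
  | zero => simp [Real.zero_rpow h1.ne']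
  | succ n ih =>
    rw [Finset.sum_range_succ, add_mul]
    have hs : (1 : ℝ) ≤ ((n + 1 : ℕ) : ℝ) := by exact_mod_cast Nat.succ_pos n
    have hkey := rpow_neg_le_sub hs hβ0 hβ1.le
    have e : ((n + 1 : ℕ) : ℝ) - 1 = (n : ℝ) := by push_cast; ring
    rw [e] at hkey
    calc (∑ i ∈ Finset.range n, (((i + 1 : ℕ) : ℝ)) ^ (-β)) * (1 - β) + (((n + 1 : ℕ) : ℝ)) ^ (-β) * (1 - β)
        ≤ (n : ℝ) ^ (1 - β) + ((((n + 1 : ℕ) : ℝ)) ^ (1 - β) - (n : ℝ) ^ (1 - β)) := by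
          rw [mul_comm ((((n + 1 : ℕ) : ℝ)) ^ (-β))]; exact add_le_add ih hkey
      _ = ((n + 1 : ℕ) : ℝ) ^ (1 - β) := by ring

/-- kernel: **Bernoulli, convex case** — `β s^{−1−β} ≤ (s−1)^{−β} − s^{−β}` for `s ≥ 2`, `0 < β ≤ 1`. [cite: Balaban1983RegularityDecay, (1.9) p.573] -/
theorem rpow_neg_succ_le_sub {s β : ℝ} (hs : 2 ≤ s) (hβ0 : 0 < β) (hβ1 : β ≤ 1) :
    β * s ^ (-(1 + β)) ≤ (s - 1) ^ (-β) - s ^ (-β) := by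
  have hs0 : 0 < s := by linarith
  have hx1 : 1 / s ≤ 1 / 2 := by rw [div_le_div_iff_of_pos_left one_pos hs0 two_pos]; exact hs
  have hx0 : 0 < 1 / s := by positivity
  -- `(1 − 1/s)^β ≤ 1 − β/s`
  have hb : (1 + (-1 / s)) ^ β ≤ 1 + β * (-1 / s) :=
    rpow_one_add_le_one_add_mul_self (by rw [neg_div]; linarith) hβ0.le hβ1
  have hpos : 0 < 1 + β * (-1 / s) := by rw [neg_div]; nlinarith
  have hq0 : 0 < 1 + (-1 / s) := by rw [neg_div]; linarith
  -- hence `(1 − 1/s)^{−β} ≥ 1/(1 − β/s) ≥ 1 + β/s`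
  have hinv : 1 + β * (1 / s) ≤ (1 + (-1 / s)) ^ (-β) := by
    rw [Real.rpow_neg hq0.le]
    have h2 : 1 + β * (1 / s) ≤ (1 + β * (-1 / s))⁻¹ := by
      have h3 : (1 + β * (1 / s)) * (1 + β * (-1 / s)) ≤ 1 := by
        have : (1 + β * (1 / s)) * (1 + β * (-1 / s)) = 1 - (β * (1 / s)) ^ 2 := by ring
        rw [this]; nlinarith [sq_nonneg (β * (1 / s))]
      have := mul_le_mul_of_nonneg_right h3 (inv_nonneg.2 hpos.le)
      rwa [mul_assoc, mul_inv_cancel₀ hpos.ne', mul_one, one_mul] at this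
    exact h2.trans (inv_anti₀ (Real.rpow_pos_of_pos hq0 β) hb)
  have hsplit : (s - 1) ^ (-β) = s ^ (-β) * (1 + (-1 / s)) ^ (-β) := by
    rw [← Real.mul_rpow hs0.le hq0.le]
    congr 1
    field_simp; ring
  have hpow : s ^ (-β) * (β * (1 / s)) = β * s ^ (-(1 + β)) := by
    rw [one_div, ← Real.rpow_neg_one, mul_comm β, ← mul_assoc, ← Real.rpow_add hs0]
    rw [show -β + -1 = -(1 + β) by ring]; ring
  have hsp : 0 ≤ s ^ (-β) := Real.rpow_nonneg hs0.le _
  calc β * s ^ (-(1 + β)) = s ^ (-β) * (1 + β * (1 / s)) - s ^ (-β) := by rw [mul_add, mul_one, hpow]; ring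
    _ ≤ s ^ (-β) * (1 + (-1 / s)) ^ (-β) - s ^ (-β) := by
        have := mul_le_mul_of_nonneg_left hinv hsp; linarith
    _ = (s - 1) ^ (-β) - s ^ (-β) := by rw [hsplit]

/-- **THE REAL-EXPONENT SUM `Σ_{s=1}^{n} s^{−1−β} ≤ 1 + 1/β`** (`0 < β ≤ 1`; the tail telescopes by `rpow_neg_succ_le_sub`). [cite: Balaban1983RegularityDecay, (1.9) p.573] -/
theorem sum_rpow_neg_succ_le {β : ℝ} (hβ0 : 0 < β) (hβ1 : β ≤ 1) (n : ℕ) :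
    ∑ i ∈ Finset.range n, (((i + 1 : ℕ) : ℝ)) ^ (-(1 + β)) ≤ 1 + 1 / β := by
  -- claim: `β·S_n ≤ β + 1 − n^{−β}` for `n ≥ 1`
  have key : ∀ n : ℕ, 1 ≤ n → β * ∑ i ∈ Finset.range n, (((i + 1 : ℕ) : ℝ)) ^ (-(1 + β)) ≤ β + 1 - (n : ℝ) ^ (-β) := by
    intro n hn
    induction n with
    | zero => omega
    | succ m ih =>
      rcases Nat.eq_zero_or_pos m with h0 | hpos
      · subst h0
        simp only [zero_add, Finset.range_one, Finset.sum_singleton, Nat.cast_one, Real.one_rpow, mul_one]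
        linarith
      · have ihm := ih hpos
        rw [Finset.sum_range_succ, mul_add]
        have hs : (2 : ℝ) ≤ ((m + 1 : ℕ) : ℝ) := by exact_mod_cast Nat.succ_le_succ hpos
        have hk := rpow_neg_succ_le_sub hs hβ0 hβ1
        have e : ((m + 1 : ℕ) : ℝ) - 1 = (m : ℝ) := by push_cast; ring
        rw [e] at hk
        linarith
  rcases Nat.eq_zero_or_pos n with h0 | hpos
  · subst h0; simp; positivity
  · have h := key n hpos
    have hn0 : 0 ≤ (n : ℝ) ^ (-β) := Real.rpow_nonneg (Nat.cast_nonneg n) _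
    have hβS : β * ∑ i ∈ Finset.range n, (((i + 1 : ℕ) : ℝ)) ^ (-(1 + β)) ≤ β * (1 + 1 / β) := by
      rw [mul_add, mul_one_div_cancel hβ0.ne', mul_one]; linarith
    exact le_of_mul_le_mul_left hβS hβ0

/-- kernel: **neighbour envelope, real exponent** — if `T ≤ T′ + 1` then `A/max(T′,1)^p ≤ 2^pA/max(T,1)^p` (`A ≥ 0`, `p ≥ 0`). [cite: Balaban1983RegularityDecay, (1.9) p.573] -/
theorem env_neighbour_rpow {T T' : ℕ} (h : T ≤ T' + 1) {p : ℝ} (hp : 0 ≤ p) {A : ℝ} (hA : 0 ≤ A) :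
    A / (max (T' : ℝ) 1) ^ p ≤ 2 ^ p * A / (max (T : ℝ) 1) ^ p := by
  have h1 : max (T : ℝ) 1 ≤ 2 * max (T' : ℝ) 1 := by
    have hT : (T : ℝ) ≤ T' + 1 := by exact_mod_cast h
    refine max_le ?_ ?_
    · have := le_max_left (T' : ℝ) 1; have := le_max_right (T' : ℝ) 1; linarith
    · have := le_max_right (T' : ℝ) 1; linarith
  have hm : 0 < max (T : ℝ) 1 := lt_max_of_lt_right one_pos
  have hm' : 0 < max (T' : ℝ) 1 := lt_max_of_lt_right one_pos
  rw [le_div_iff₀ (Real.rpow_pos_of_pos hm _), div_mul_eq_mul_div, div_le_iff₀ (Real.rpow_pos_of_pos hm' _)]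
  calc A * (max (T : ℝ) 1) ^ p ≤ A * (2 * max (T' : ℝ) 1) ^ p :=
        mul_le_mul_of_nonneg_left (Real.rpow_le_rpow hm.le h1 hp) hA
    _ = 2 ^ p * A * (max (T' : ℝ) 1) ^ p := by rw [Real.mul_rpow zero_le_two hm'.le]; ring

/-- kernel: **far envelope, real exponent** — if `ρ/2 ≤ T` (`ρ > 0`) then `A/max(T,1)^p ≤ A(2/ρ)^p` (`A ≥ 0`, `p ≥ 0`). [cite: Balaban1983RegularityDecay, (1.9) p.573] -/
theorem env_far_rpow {T : ℕ} {ρ : ℝ} (hρ : 0 < ρ) (h : ρ / 2 ≤ (T : ℝ)) {p : ℝ} (hp : 0 ≤ p) {A : ℝ} (hA : 0 ≤ A) :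
    A / (max (T : ℝ) 1) ^ p ≤ A * (2 / ρ) ^ p := by
  have hm : ρ / 2 ≤ max (T : ℝ) 1 := h.trans (le_max_left _ _)
  have hm0 : 0 < max (T : ℝ) 1 := lt_max_of_lt_right one_pos
  rw [div_eq_mul_inv, ← Real.inv_rpow hm0.le]
  refine mul_le_mul_of_nonneg_left (Real.rpow_le_rpow (inv_nonneg.2 hm0.le) ?_ hp) hA
  rw [inv_le_comm₀ hm0 (by positivity), inv_div]; exact hm

variable {P : Params} {j : ℕ}

/-- kernel: on a shell of radius `s ≥ 1`, `(2s+1)^{d−1}·s^{−(d−1+β)} ≤ 3^{d−1}s^{−β}`. [cite: Balaban1983RegularityDecay, (1.9) p.573] -/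
theorem shell_rpow_le (hd : 1 ≤ P.d) {s : ℝ} (hs : 1 ≤ s) (β : ℝ) :
    (2 * s + 1) ^ (P.d - 1) / s ^ ((P.d : ℝ) - 1 + β) ≤ 3 ^ (P.d - 1) * s ^ (-β) := by
  have hs0 : 0 < s := by linarith
  have h1 := shellFactor_le hs (P.d - 1)
  have hsplit : s ^ ((P.d : ℝ) - 1 + β) = s ^ (P.d - 1) * s ^ β := by
    rw [Real.rpow_add hs0]
    congr 1
    rw [← Real.rpow_natCast, Nat.cast_sub hd, Nat.cast_one]
  rw [hsplit, Real.rpow_neg hs0.le, div_le_iff₀ (by positivity)]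
  calc (2 * s + 1) ^ (P.d - 1) ≤ 3 ^ (P.d - 1) * s ^ (P.d - 1) := h1
    _ = 3 ^ (P.d - 1) * (s ^ β)⁻¹ * (s ^ (P.d - 1) * s ^ β) := by
        have : (s ^ β)⁻¹ * s ^ β = 1 := inv_mul_cancel₀ (Real.rpow_pos_of_pos hs0 β).ne'
        calc (3 : ℝ) ^ (P.d - 1) * s ^ (P.d - 1) = 3 ^ (P.d - 1) * s ^ (P.d - 1) * ((s ^ β)⁻¹ * s ^ β) := by rw [this, mul_one]
          _ = _ := by ring

/-- kernel: on a shell of radius `s ≥ 1`, `(2s+1)^{d−1}·s^{−(d+β)} ≤ 3^{d−1}s^{−(1+β)}`. [cite: Balaban1983RegularityDecay, (1.9) p.573] -/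
theorem shell_rpow_succ_le (hd : 1 ≤ P.d) {s : ℝ} (hs : 1 ≤ s) (β : ℝ) :
    (2 * s + 1) ^ (P.d - 1) / s ^ ((P.d : ℝ) + β) ≤ 3 ^ (P.d - 1) * s ^ (-(1 + β)) := by
  have h := shell_rpow_le hd hs (1 + β)
  rwa [show (P.d : ℝ) - 1 + (1 + β) = (P.d : ℝ) + β by ring] at h

/-- **RADIAL BOUND, PROFILE `A/max(T,1)^{d−1+β}`** (`0 ≤ β < 1`): a real function `g ≤ A/max(|y₀−z|_∞,1)^{d−1+β}` on the ball of radius `n`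
and `≤ 0` outside has `Σ_z g(z) ≤ A(1 + 2d3^{d−1}n^{1−β}/(1−β))`. [cite: Balaban1983RegularityDecay, (1.9) p.573] -/
theorem radial_env_rpow (hd : 1 ≤ P.d) (y₀ : Balaban1983to89.Site P j) (n : ℕ) {A : ℝ} (hA : 0 ≤ A) {β : ℝ} (hβ0 : 0 ≤ β)
    (hβ1 : β < 1) (g : Balaban1983to89.Site P j → ℝ)
    (hg : ∀ z, supDist y₀ z ≤ n → g z ≤ A / (max (supDist y₀ z : ℝ) 1) ^ ((P.d : ℝ) - 1 + β))
    (hg' : ∀ z, n < supDist y₀ z → g z ≤ 0) :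
    ∑ z, g z ≤ A * (1 + 2 * P.d * 3 ^ (P.d - 1) * ((n : ℝ) ^ (1 - β) / (1 - β))) := by
  have h := sum_le_radial y₀ n (fun s => A / (max (s : ℝ) 1) ^ ((P.d : ℝ) - 1 + β)) (fun s => by positivity) g hg hg'
  refine h.trans ?_
  simp only [Nat.cast_zero]
  rw [max_eq_right (zero_le_one' ℝ), Real.one_rpow, div_one]
  have hterm : ∀ i ∈ Finset.range n,
      2 * (P.d : ℝ) * (2 * ((i + 1 : ℕ) : ℝ) + 1) ^ (P.d - 1) * (A / (max (((i + 1 : ℕ) : ℝ)) 1) ^ ((P.d : ℝ) - 1 + β)) ≤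
        2 * P.d * 3 ^ (P.d - 1) * A * (((i + 1 : ℕ) : ℝ)) ^ (-β) := by
    intro i _
    have hs : (1 : ℝ) ≤ ((i + 1 : ℕ) : ℝ) := by exact_mod_cast Nat.succ_pos i
    rw [max_cast_succ]
    have h1 := shell_rpow_le hd hs β
    calc 2 * (P.d : ℝ) * (2 * ((i + 1 : ℕ) : ℝ) + 1) ^ (P.d - 1) * (A / (((i + 1 : ℕ) : ℝ)) ^ ((P.d : ℝ) - 1 + β))
        = 2 * P.d * A * ((2 * ((i + 1 : ℕ) : ℝ) + 1) ^ (P.d - 1) / (((i + 1 : ℕ) : ℝ)) ^ ((P.d : ℝ) - 1 + β)) := by ring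
      _ ≤ 2 * P.d * A * (3 ^ (P.d - 1) * (((i + 1 : ℕ) : ℝ)) ^ (-β)) := mul_le_mul_of_nonneg_left h1 (by positivity)
      _ = _ := by ring
  have hsum := sum_rpow_neg_le hβ0 hβ1 n
  calc A + ∑ i ∈ Finset.range n, 2 * (P.d : ℝ) * (2 * ((i + 1 : ℕ) : ℝ) + 1) ^ (P.d - 1) *
        (A / (max (((i + 1 : ℕ) : ℝ)) 1) ^ ((P.d : ℝ) - 1 + β))
      ≤ A + ∑ i ∈ Finset.range n, 2 * P.d * 3 ^ (P.d - 1) * A * (((i + 1 : ℕ) : ℝ)) ^ (-β) :=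
        add_le_add_right (Finset.sum_le_sum hterm) A
    _ = A + 2 * P.d * 3 ^ (P.d - 1) * A * ∑ i ∈ Finset.range n, (((i + 1 : ℕ) : ℝ)) ^ (-β) := by rw [Finset.mul_sum]
    _ ≤ A + 2 * P.d * 3 ^ (P.d - 1) * A * ((n : ℝ) ^ (1 - β) / (1 - β)) := by gcongr
    _ = _ := by ring

/-- **RADIAL BOUND, PROFILE `A·T/max(T,1)^{d−1+β}`** (`0 ≤ β < 1`): `Σ_z g(z) ≤ 2d3^{d−1}A·n·n^{1−β}`. [cite: Balaban1983RegularityDecay, (1.9) p.573] -/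
theorem radial_env_rpow_T (hd : 1 ≤ P.d) (y₀ : Balaban1983to89.Site P j) (n : ℕ) {A : ℝ} (hA : 0 ≤ A) {β : ℝ} (hβ1 : β < 1)
    (g : Balaban1983to89.Site P j → ℝ)
    (hg : ∀ z, supDist y₀ z ≤ n → g z ≤ A * (supDist y₀ z : ℝ) / (max (supDist y₀ z : ℝ) 1) ^ ((P.d : ℝ) - 1 + β))
    (hg' : ∀ z, n < supDist y₀ z → g z ≤ 0) :
    ∑ z, g z ≤ 2 * P.d * 3 ^ (P.d - 1) * A * (n * (n : ℝ) ^ (1 - β)) := by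
  have h := sum_le_radial y₀ n (fun s => A * (s : ℝ) / (max (s : ℝ) 1) ^ ((P.d : ℝ) - 1 + β)) (fun s => by positivity) g hg hg'
  refine h.trans ?_
  simp only [Nat.cast_zero, mul_zero, zero_div, zero_add]
  have hterm : ∀ i ∈ Finset.range n,
      2 * (P.d : ℝ) * (2 * ((i + 1 : ℕ) : ℝ) + 1) ^ (P.d - 1) *
          (A * ((i + 1 : ℕ) : ℝ) / (max (((i + 1 : ℕ) : ℝ)) 1) ^ ((P.d : ℝ) - 1 + β)) ≤
        2 * P.d * 3 ^ (P.d - 1) * A * (n : ℝ) ^ (1 - β) := by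
    intro i hi
    rw [Finset.mem_range] at hi
    have hs : (1 : ℝ) ≤ ((i + 1 : ℕ) : ℝ) := by exact_mod_cast Nat.succ_pos i
    have hs0 : (0 : ℝ) < ((i + 1 : ℕ) : ℝ) := by linarith
    have hsn : ((i + 1 : ℕ) : ℝ) ≤ n := by exact_mod_cast hi
    rw [max_cast_succ]
    have h1 := shell_rpow_le hd hs β
    have h2 : (((i + 1 : ℕ) : ℝ)) * (((i + 1 : ℕ) : ℝ)) ^ (-β) = (((i + 1 : ℕ) : ℝ)) ^ (1 - β) := by
      rw [sub_eq_add_neg, Real.rpow_add hs0, Real.rpow_one]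
    have h3 : (((i + 1 : ℕ) : ℝ)) ^ (1 - β) ≤ (n : ℝ) ^ (1 - β) := Real.rpow_le_rpow hs0.le hsn (by linarith)
    calc 2 * (P.d : ℝ) * (2 * ((i + 1 : ℕ) : ℝ) + 1) ^ (P.d - 1) *
          (A * ((i + 1 : ℕ) : ℝ) / (((i + 1 : ℕ) : ℝ)) ^ ((P.d : ℝ) - 1 + β))
        = 2 * P.d * A * ((i + 1 : ℕ) : ℝ) *
            ((2 * ((i + 1 : ℕ) : ℝ) + 1) ^ (P.d - 1) / (((i + 1 : ℕ) : ℝ)) ^ ((P.d : ℝ) - 1 + β)) := by ring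
      _ ≤ 2 * P.d * A * ((i + 1 : ℕ) : ℝ) * (3 ^ (P.d - 1) * (((i + 1 : ℕ) : ℝ)) ^ (-β)) :=
          mul_le_mul_of_nonneg_left h1 (by positivity)
      _ = 2 * P.d * 3 ^ (P.d - 1) * A * ((((i + 1 : ℕ) : ℝ)) * (((i + 1 : ℕ) : ℝ)) ^ (-β)) := by ring
      _ ≤ 2 * P.d * 3 ^ (P.d - 1) * A * (n : ℝ) ^ (1 - β) := by rw [h2]; gcongr
  calc _ ≤ ∑ _i ∈ Finset.range n, 2 * (P.d : ℝ) * 3 ^ (P.d - 1) * A * (n : ℝ) ^ (1 - β) := Finset.sum_le_sum hterm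
    _ = _ := by rw [Finset.sum_const, Finset.card_range, nsmul_eq_mul]; ring

/-- **RADIAL BOUND, PROFILE `A/max(T,1)^{d+β}`** (`0 < β ≤ 1`): `Σ_z g(z) ≤ A(1 + 2d3^{d−1}(1 + 1/β))` — uniformly in the radius. [cite: Balaban1983RegularityDecay, (1.9) p.573] -/
theorem radial_env_rpow_succ (hd : 1 ≤ P.d) (y₀ : Balaban1983to89.Site P j) (n : ℕ) {A : ℝ} (hA : 0 ≤ A) {β : ℝ} (hβ0 : 0 < β)
    (hβ1 : β ≤ 1) (g : Balaban1983to89.Site P j → ℝ)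
    (hg : ∀ z, supDist y₀ z ≤ n → g z ≤ A / (max (supDist y₀ z : ℝ) 1) ^ ((P.d : ℝ) + β))
    (hg' : ∀ z, n < supDist y₀ z → g z ≤ 0) :
    ∑ z, g z ≤ A * (1 + 2 * P.d * 3 ^ (P.d - 1) * (1 + 1 / β)) := by
  have h := sum_le_radial y₀ n (fun s => A / (max (s : ℝ) 1) ^ ((P.d : ℝ) + β)) (fun s => by positivity) g hg hg'
  refine h.trans ?_
  simp only [Nat.cast_zero]
  rw [max_eq_right (zero_le_one' ℝ), Real.one_rpow, div_one]
  have hterm : ∀ i ∈ Finset.range n,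
      2 * (P.d : ℝ) * (2 * ((i + 1 : ℕ) : ℝ) + 1) ^ (P.d - 1) * (A / (max (((i + 1 : ℕ) : ℝ)) 1) ^ ((P.d : ℝ) + β)) ≤
        2 * P.d * 3 ^ (P.d - 1) * A * (((i + 1 : ℕ) : ℝ)) ^ (-(1 + β)) := by
    intro i _
    have hs : (1 : ℝ) ≤ ((i + 1 : ℕ) : ℝ) := by exact_mod_cast Nat.succ_pos i
    rw [max_cast_succ]
    have h1 := shell_rpow_succ_le hd hs β
    calc 2 * (P.d : ℝ) * (2 * ((i + 1 : ℕ) : ℝ) + 1) ^ (P.d - 1) * (A / (((i + 1 : ℕ) : ℝ)) ^ ((P.d : ℝ) + β))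
        = 2 * P.d * A * ((2 * ((i + 1 : ℕ) : ℝ) + 1) ^ (P.d - 1) / (((i + 1 : ℕ) : ℝ)) ^ ((P.d : ℝ) + β)) := by ring
      _ ≤ 2 * P.d * A * (3 ^ (P.d - 1) * (((i + 1 : ℕ) : ℝ)) ^ (-(1 + β))) := mul_le_mul_of_nonneg_left h1 (by positivity)
      _ = _ := by ring
  have hsum := sum_rpow_neg_succ_le hβ0 hβ1 n
  calc A + ∑ i ∈ Finset.range n, 2 * (P.d : ℝ) * (2 * ((i + 1 : ℕ) : ℝ) + 1) ^ (P.d - 1) *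
        (A / (max (((i + 1 : ℕ) : ℝ)) 1) ^ ((P.d : ℝ) + β))
      ≤ A + ∑ i ∈ Finset.range n, 2 * P.d * 3 ^ (P.d - 1) * A * (((i + 1 : ℕ) : ℝ)) ^ (-(1 + β)) :=
        add_le_add_right (Finset.sum_le_sum hterm) A
    _ = A + 2 * P.d * 3 ^ (P.d - 1) * A * ∑ i ∈ Finset.range n, (((i + 1 : ℕ) : ℝ)) ^ (-(1 + β)) := by rw [Finset.mul_sum]
    _ ≤ A + 2 * P.d * 3 ^ (P.d - 1) * A * (1 + 1 / β) := by gcongr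
    _ = _ := by ring

/-- **RADIAL BOUND, PROFILE `A·T/max(T,1)^{d+β}`** (`0 ≤ β < 1`): `Σ_z g(z) ≤ A·2d3^{d−1}n^{1−β}/(1−β)`. [cite: Balaban1983RegularityDecay, (1.9) p.573] -/
theorem radial_env_rpow_succ_T (hd : 1 ≤ P.d) (y₀ : Balaban1983to89.Site P j) (n : ℕ) {A : ℝ} (hA : 0 ≤ A) {β : ℝ} (hβ0 : 0 ≤ β)
    (hβ1 : β < 1) (g : Balaban1983to89.Site P j → ℝ)
    (hg : ∀ z, supDist y₀ z ≤ n → g z ≤ A * (supDist y₀ z : ℝ) / (max (supDist y₀ z : ℝ) 1) ^ ((P.d : ℝ) + β))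
    (hg' : ∀ z, n < supDist y₀ z → g z ≤ 0) :
    ∑ z, g z ≤ A * (2 * P.d * 3 ^ (P.d - 1) * ((n : ℝ) ^ (1 - β) / (1 - β))) := by
  have h := sum_le_radial y₀ n (fun s => A * (s : ℝ) / (max (s : ℝ) 1) ^ ((P.d : ℝ) + β)) (fun s => by positivity) g hg hg'
  refine h.trans ?_
  simp only [Nat.cast_zero, mul_zero, zero_div, zero_add]
  have hterm : ∀ i ∈ Finset.range n,
      2 * (P.d : ℝ) * (2 * ((i + 1 : ℕ) : ℝ) + 1) ^ (P.d - 1) *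
          (A * ((i + 1 : ℕ) : ℝ) / (max (((i + 1 : ℕ) : ℝ)) 1) ^ ((P.d : ℝ) + β)) ≤
        2 * P.d * 3 ^ (P.d - 1) * A * (((i + 1 : ℕ) : ℝ)) ^ (-β) := by
    intro i _
    have hs : (1 : ℝ) ≤ ((i + 1 : ℕ) : ℝ) := by exact_mod_cast Nat.succ_pos i
    have hs0 : (0 : ℝ) < ((i + 1 : ℕ) : ℝ) := by linarith
    rw [max_cast_succ]
    have h1 := shell_rpow_succ_le hd hs β
    have h2 : (((i + 1 : ℕ) : ℝ)) * (((i + 1 : ℕ) : ℝ)) ^ (-(1 + β)) = (((i + 1 : ℕ) : ℝ)) ^ (-β) := by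
      rw [show -β = 1 + -(1 + β) by ring, Real.rpow_add hs0, Real.rpow_one]
    calc 2 * (P.d : ℝ) * (2 * ((i + 1 : ℕ) : ℝ) + 1) ^ (P.d - 1) *
          (A * ((i + 1 : ℕ) : ℝ) / (((i + 1 : ℕ) : ℝ)) ^ ((P.d : ℝ) + β))
        = 2 * P.d * A * ((i + 1 : ℕ) : ℝ) *
            ((2 * ((i + 1 : ℕ) : ℝ) + 1) ^ (P.d - 1) / (((i + 1 : ℕ) : ℝ)) ^ ((P.d : ℝ) + β)) := by ring
      _ ≤ 2 * P.d * A * ((i + 1 : ℕ) : ℝ) * (3 ^ (P.d - 1) * (((i + 1 : ℕ) : ℝ)) ^ (-(1 + β))) :=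
          mul_le_mul_of_nonneg_left h1 (by positivity)
      _ = 2 * P.d * 3 ^ (P.d - 1) * A * ((((i + 1 : ℕ) : ℝ)) * (((i + 1 : ℕ) : ℝ)) ^ (-(1 + β))) := by ring
      _ = _ := by rw [h2]
  have hsum := sum_rpow_neg_le hβ0 hβ1 n
  calc _ ≤ ∑ i ∈ Finset.range n, 2 * (P.d : ℝ) * 3 ^ (P.d - 1) * A * (((i + 1 : ℕ) : ℝ)) ^ (-β) := Finset.sum_le_sum hterm
    _ = 2 * P.d * 3 ^ (P.d - 1) * A * ∑ i ∈ Finset.range n, (((i + 1 : ℕ) : ℝ)) ^ (-β) := by rw [Finset.mul_sum]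
    _ ≤ 2 * P.d * 3 ^ (P.d - 1) * A * ((n : ℝ) ^ (1 - β) / (1 - β)) := by gcongr
    _ = _ := by ring

end RealRadial


end

end Literature.MathematicalPhysics.QuantumFieldTheory.BalabanImbrieJaffe1984to88.BIJ85TorusTentCutoff
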